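import Mathlib
import Summits.NavierStokesRegularity.NavierStokesRegularity.Theorems.EulerZoomLiouvillePowerGaugeEulerLiouvilleClassicalConcentrating
import Summits.NavierStokesRegularity.NavierStokesRegularity.Theorems.EulerZoomLiouvillePowerGaugeEulerLiouvilleEnergyVanishingTools
import Summits.NavierStokesRegularity.NavierStokesRegularity.Theorems.EulerZoomLiouvillePowerGaugeEulerLiouvilleSelfSimilarEndpointMember
import HarnessLib.Audit

/-!
# Crux `EulerZoomLiouville.PowerGaugeEulerLiouville` at the endpoint `ρ = 1/2`: TYPE-I CLASSICAL
# ENERGY-CONCENTRATING MEMBERS ARE TRIVIAL (Chae–Wolf's hypotheses + the two far-field inputs)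

Route №10 `EulerZoomLiouville` (NavierStokesRegularity), crux E = stmt-NavierStokesRegularity-19832,
registered stubs `stub_classicalConcentrating` (filled) / residues of skeleton v10.  Sequel to
`…ClassicalConcentrating` (`KelvinPhysical.ae_eq_zero_of_gauge_of_concentrating`): at the
energy-conserving endpoint the velocity bound (a) `‖u(τ,x)‖ ≤ M(−τ)^{−3/5}` and the slice
integrability `u(τ) ∈ L²` are CONSEQUENCES of the Type-I gradient bound (d) and of the `A`-gauge
(finite energy `≤ c`, tree `lintegral_enorm_sq_le_of_gauge_half`), through the elementary
Gagliardo–Nirenberg-type bound for Lipschitz square-integrable fields: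

* `norm_pow_five_le_of_lipschitz_of_lintegral` — if `v` is `K`-Lipschitz (`K > 0`) and
  `∫ ‖v‖² ≤ E` then `‖v(x)‖⁵ ≤ 32 K³ E / vol(B₁)` (on `B(x, ‖v(x)‖/(2K))`, `‖v‖ ≥ ‖v(x)‖/2`);
* `ae_eq_zero_of_gauge_half_of_typeI_concentrating` — **MEMBER LEVEL at `ρ = 1/2`**: crux
  hypotheses VERBATIM + classical Euler on the past + Type I `‖∇u(τ,x)‖ ≤ K/(−τ)` + far-field
  gradient smallness (`∀ ε ∃ R`: `‖∇u(τ,x)‖ ≤ ε/(−τ)` for `|x| ≥ R(−τ)^{2/5}`) + tail energy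
  `∫_{|x|≥r}|u(τ)|² ≤ C r^{−β}(−τ)^{2β/5}` (`r ≥ R₀(−τ)^{2/5}`, some `β > 0`) ⇒ `u = 0` a.e.
  These are Chae–Wolf's hypotheses (CMP 376 (2020) Thm 1.1/Cor 1.5: `L^∞_t L²_x ∩ L^∞_loc W^{1,∞}`
  + Type I) inside Seregin's class, plus the far-field gradient decay and the power tail in the
  similarity scaling (which Chae–Wolf derive from one-point concentration by the local pressure;
  here they are hypotheses).

WHAT THIS IS NOT: not NS, not E, not the residues of v10 — weak-class members and classical members
without far-field control are untouched.

## References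

* D. Chae, J. Wolf, Comm. Math. Phys. 376 (2020) = arXiv:1706.02020, Thm 1.1, Cor 1.5, Lemma 3.3.
  [ChaeWolf2020EulerTypeI]
* A. J. Majda, A. L. Bertozzi, *Vorticity and Incompressible Flow*, CUP 2002, §1.6. [MajdaBertozziCUP2002]
-/

noncomputable section

-- flat `Theorems/<Route><Decl>…` files of one crux share the namespace of the crux (tree convention)
set_option linter.dupNamespace false

open MeasureTheory Set Filter Topology Metric Function InnerProductSpace
open scoped RealInnerProductSpace NNReal ENNReal ContDiff

namespace Summit.NavierStokesRegularity.NavierStokesRegularity.Theorems.PowerGaugeEulerLiouville.KelvinPhysical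

open Literature.Analysis Literature.Analysis.FunctionSpaces Literature.Analysis.FluidPDE

/-- **Gagliardo–Nirenberg for Lipschitz square-integrable fields** (Chae–Wolf Lemma 3.3's
`‖v‖_∞ ≤ c ‖v‖₂^{2/5} ‖∇v‖_∞^{3/5}` in elementary form): if `v` is `K`-Lipschitz, `K > 0`, and
`∫ ‖v‖² ≤ E` then `‖v(x)‖⁵ ≤ 32 K³ E / vol(B₁)` for every `x`.
[cite: ChaeWolf2020EulerTypeI, Lemma 3.3] -/
theorem norm_pow_five_le_of_lipschitz_of_integral {v : EuclideanSpace ℝ (Fin 3) → EuclideanSpace ℝ (Fin 3)}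
    {K : ℝ} (hK : 0 < K) (hv : LipschitzWith ⟨K, hK.le⟩ v)
    (hint : Integrable (fun x => ‖v x‖ ^ 2) volume) {E : ℝ} (hE : ∫ x, ‖v x‖ ^ 2 ≤ E)
    (x : EuclideanSpace ℝ (Fin 3)) :
    ‖v x‖ ^ 5 ≤ 32 * K ^ 3 * E / (volume (ball (0 : EuclideanSpace ℝ (Fin 3)) 1)).toReal := by
  have hV1 : 0 < (volume (ball (0 : EuclideanSpace ℝ (Fin 3)) 1)).toReal :=
    ENNReal.toReal_pos (measure_ball_pos volume 0 one_pos).ne' measure_ball_lt_top.ne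
  set m : ℝ := ‖v x‖ with hm
  have hm0 : 0 ≤ m := norm_nonneg _
  rcases hm0.eq_or_lt with hmz | hmpos
  · rw [← hmz]; simp only [ne_eq, OfNat.ofNat_ne_zero, not_false_eq_true, zero_pow]
    have hE0 : 0 ≤ E := (integral_nonneg fun y => by positivity).trans hE
    positivity
  set r : ℝ := m / (2 * K) with hr
  have hr0 : 0 < r := by positivity
  -- on `B(x, r)`: `‖v‖ ≥ m/2`
  have hlow : ∀ y ∈ ball x r, (m / 2) ^ 2 ≤ ‖v y‖ ^ 2 := by
    intro y hy
    have h1 : ‖v y - v x‖ ≤ K * dist y x := by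
      rw [← dist_eq_norm]; exact hv.dist_le_mul y x
    have h2 : K * dist y x ≤ m / 2 := by
      have : dist y x < r := mem_ball.1 hy
      calc K * dist y x ≤ K * r := mul_le_mul_of_nonneg_left this.le hK.le
        _ = m / 2 := by rw [hr]; field_simp
    have h3 : m / 2 ≤ ‖v y‖ := by
      have := norm_sub_norm_le (v x) (v y)
      rw [← norm_neg, neg_sub] at h1
      linarith
    exact pow_le_pow_left₀ (by positivity) h3 2
  have hball : (m / 2) ^ 2 * (volume (ball x r)).toReal ≤ ∫ y in ball x r, ‖v y‖ ^ 2 := by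
    have h := setIntegral_mono_on (integrableOn_const measure_ball_lt_top.ne) hint.integrableOn
      measurableSet_ball hlow
    rwa [setIntegral_const, smul_eq_mul, mul_comm, measureReal_def] at h
  have hvolr : (volume (ball x r)).toReal = r ^ 3 * (volume (ball (0 : EuclideanSpace ℝ (Fin 3)) 1)).toReal := by
    rw [Measure.addHaar_ball volume x hr0.le, ENNReal.toReal_mul, finrank_euclideanSpace_fin,
      ENNReal.toReal_ofReal (by positivity)]
  have hle : ∫ y in ball x r, ‖v y‖ ^ 2 ≤ E :=
    (setIntegral_le_integral hint (Eventually.of_forall fun y => by positivity)).trans hE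
  rw [hvolr] at hball
  -- `(m/2)² (m/(2K))³ V₁ ≤ E`, i.e. `m⁵ ≤ 32 K³ E / V₁`
  rw [le_div_iff₀ hV1]
  have h1 : (m / 2) ^ 2 * (r ^ 3 * (volume (ball (0 : EuclideanSpace ℝ (Fin 3)) 1)).toReal) ≤ E :=
    hball.trans hle
  rw [hr] at h1
  have h2 : (m / 2) ^ 2 * ((m / (2 * K)) ^ 3 * (volume (ball (0 : EuclideanSpace ℝ (Fin 3)) 1)).toReal)
      = m ^ 5 * (volume (ball (0 : EuclideanSpace ℝ (Fin 3)) 1)).toReal / (32 * K ^ 3) := by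
    field_simp; ring
  rw [h2, div_le_iff₀ (by positivity)] at h1
  linarith

/-- **The endpoint, Type-I form of the classical energy-concentrating stratum.**  At `ρ = 1/2`
the three crux hypotheses, a classical Euler pair on the past with the Type-I gradient bound
`‖∇u(τ,x)‖ ≤ K/(−τ)`, far-field gradient smallness in the similarity scaling `x ~ (−τ)^{2/5}` and a
power tail `∫_{|x|≥r}|u(τ)|² ≤ C r^{−β}(−τ)^{2β/5}` force `u = 0` a.e. (the velocity bound
`‖u‖ ≤ M(−τ)^{−3/5}` and `u(τ) ∈ L²` come from the `A`-gauge energy bound `≤ c` and the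
Gagliardo–Nirenberg bound above; then `ae_eq_zero_of_gauge_of_concentrating`).
[cite: ChaeWolf2020EulerTypeI, Thm 1.1, Cor. 1.5, Lemma 3.3] -/
theorem ae_eq_zero_of_gauge_half_of_typeI_concentrating
    {u : ℝ → EuclideanSpace ℝ (Fin 3) → EuclideanSpace ℝ (Fin 3)}
    {p : ℝ → EuclideanSpace ℝ (Fin 3) → ℝ}
    {H : ℝ → EuclideanSpace ℝ (Fin 3) → EuclideanSpace ℝ (Fin 3) →L[ℝ] EuclideanSpace ℝ (Fin 3)}
    {c : ℝ≥0}
    (hsw : IsSuitableWeakSolutionOn (slab (EuclideanSpace ℝ (Fin 3)) (Iio 0) isOpen_Iio) 0 0 u p)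
    (hH : HasWeakSpatialGradientOn (slab (EuclideanSpace ℝ (Fin 3)) (Iio 0) isOpen_Iio) u H)
    (hgauge : ∀ a : ℝ, 0 < a →
      ENNReal.ofReal (a ^ (2 * (1 / 2 : ℝ))) * cknA a (0 : ℝ × EuclideanSpace ℝ (Fin 3)) u +
          ENNReal.ofReal (a ^ (1 / 2 : ℝ)) * cknE a (0 : ℝ × EuclideanSpace ℝ (Fin 3)) H +
        ENNReal.ofReal (a ^ (2 * (1 / 2 : ℝ))) * cknD a (0 : ℝ × EuclideanSpace ℝ (Fin 3)) p ≤
          (c : ℝ≥0∞))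
    (hcl : IsClassicalEulerSolutionOn (Iio 0) 0 u p)
    {K : ℝ} (hK : ∀ τ : ℝ, τ < 0 → ∀ x, ‖fderiv ℝ (u τ) x‖ ≤ K / (-τ))
    (hfar : ∀ ε : ℝ, 0 < ε → ∃ R : ℝ, 0 ≤ R ∧ ∀ τ : ℝ, τ < 0 → ∀ x : EuclideanSpace ℝ (Fin 3),
      R * (-τ) ^ (1 / (2 + (1 / 2 : ℝ))) ≤ ‖x‖ → ‖fderiv ℝ (u τ) x‖ ≤ ε / (-τ))
    {β C R₀ : ℝ} (hβ : 0 < β) (hR₀ : 0 ≤ R₀)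
    (htail : ∀ τ : ℝ, τ < 0 → ∀ r : ℝ, R₀ * (-τ) ^ (1 / (2 + (1 / 2 : ℝ))) ≤ r →
      ∫ x in {x | r ≤ ‖x‖}, ‖u τ x‖ ^ 2 ≤ C * r ^ (-β) * (-τ) ^ (1 / (2 + (1 / 2 : ℝ)) * β)) :
    uncurry u =ᵐ[volume.restrict (Iio (0 : ℝ) ×ˢ (univ : Set (EuclideanSpace ℝ (Fin 3))))] 0 := by
  have hA : ∀ a : ℝ, 0 < a → ENNReal.ofReal (a ^ (2 * (1 / 2 : ℝ))) *
      cknA a (0 : ℝ × EuclideanSpace ℝ (Fin 3)) u ≤ (c : ℝ≥0∞) :=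
    fun a ha => le_trans (le_trans le_self_add le_self_add) (hgauge a ha)
  -- slices are square integrable, with energy `≤ c`
  have hu2 : ∀ τ : ℝ, τ < 0 → Integrable (fun x => ‖u τ x‖ ^ 2) volume := fun τ hτ =>
    integrable_norm_sq_of_lintegral_lt_top (hcl.contDiff_velocity hτ).continuous.aestronglyMeasurable
      (lt_of_le_of_lt (lintegral_enorm_sq_le_of_gauge_half hA hτ) ENNReal.coe_lt_top)
  have hE : ∀ τ : ℝ, τ < 0 → ∫ x, ‖u τ x‖ ^ 2 ≤ (c : ℝ) := by
    intro τ hτ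
    have h1 := lintegral_enorm_sq_le_of_gauge_half hA hτ
    have h2 : ∫ x, ‖u τ x‖ ^ 2 = (∫⁻ x, ‖u τ x‖ₑ ^ 2).toReal := by
      rw [integral_eq_lintegral_of_nonneg_ae (Eventually.of_forall fun x => by positivity)
        (hu2 τ hτ).aestronglyMeasurable]
      congr 1
      refine lintegral_congr fun x => ?_
      rw [← ofReal_norm, ← ENNReal.ofReal_pow (norm_nonneg _)]
    rw [h2]
    exact ENNReal.toReal_le_coe_of_le_coe h1
  -- the Type-I velocity bound `‖u(τ,x)‖ ≤ M (−τ)^{−3/5}` from Gagliardo–Nirenberg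
  set K' : ℝ := |K| + 1 with hK'
  have hK'0 : 0 < K' := by positivity
  set V₁ : ℝ := (volume (ball (0 : EuclideanSpace ℝ (Fin 3)) 1)).toReal with hV₁
  have hV₁0 : 0 < V₁ := ENNReal.toReal_pos (measure_ball_pos volume 0 one_pos).ne' measure_ball_lt_top.ne
  set M : ℝ := (32 * K' ^ 3 * c / V₁) ^ (1 / 5 : ℝ) with hM
  have hvel : ∀ τ : ℝ, τ < 0 → ∀ x, ‖u τ x‖ ≤ M * (-τ) ^ (1 / (2 + (1 / 2 : ℝ)) - 1) := by
    intro τ hτ x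
    have hτ0 : 0 < -τ := by linarith
    -- `u τ` is `K'/(−τ)`-Lipschitz
    have hLipK : ∀ y, ‖fderiv ℝ (u τ) y‖ ≤ K' / (-τ) := fun y =>
      (hK τ hτ y).trans (div_le_div_of_nonneg_right (by rw [hK']; linarith [le_abs_self K]) hτ0.le)
    have hKnn : 0 ≤ K' / (-τ) := by positivity
    have hLip : LipschitzWith ⟨K' / (-τ), hKnn⟩ (u τ) :=
      lipschitzWith_of_nnnorm_fderiv_le ((hcl.contDiff_velocity hτ).differentiable (by simp))
        fun y => by have h := hLipK y; exact_mod_cast h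
    have h5 := norm_pow_five_le_of_lipschitz_of_integral (div_pos hK'0 hτ0) hLip (hu2 τ hτ) (hE τ hτ) x
    -- `‖u‖⁵ ≤ 32 K'³ c / V₁ · (−τ)^{−3}`
    have h6 : ‖u τ x‖ ^ 5 ≤ (32 * K' ^ 3 * c / V₁) * ((-τ) ^ (3 : ℕ))⁻¹ := by
      refine h5.trans (le_of_eq ?_)
      rw [hV₁, div_pow]
      field_simp
    have hbase : 0 ≤ 32 * K' ^ 3 * c / V₁ := by positivity
    have h7 : ‖u τ x‖ ≤ ((32 * K' ^ 3 * c / V₁) * ((-τ) ^ (3 : ℕ))⁻¹) ^ (1 / 5 : ℝ) := by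
      have := Real.rpow_le_rpow (by positivity) h6 (by norm_num : (0 : ℝ) ≤ 1 / 5)
      rwa [← Real.rpow_natCast, ← Real.rpow_mul (norm_nonneg _), show ((5 : ℕ) : ℝ) * (1 / 5) = 1 by
        norm_num, Real.rpow_one] at this
    refine h7.trans (le_of_eq ?_)
    rw [Real.mul_rpow hbase (by positivity), hM, show (1 / (2 + (1 / 2 : ℝ)) - 1) = -(3 / 5 : ℝ) by
      norm_num]
    congr 1
    rw [← Real.rpow_natCast, ← Real.rpow_neg hτ0.le, ← Real.rpow_mul hτ0.le]
    norm_num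
  exact ae_eq_zero_of_gauge_of_concentrating (by norm_num) hsw hH hgauge hcl hvel hK hfar hβ hR₀
    htail hu2

end Summit.NavierStokesRegularity.NavierStokesRegularity.Theorems.PowerGaugeEulerLiouville.KelvinPhysical

end
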